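/-
Copyright: public-domain mathematics; formalisation produced inside the b2b autopsy cell `lwe-quantum-autopsy`
(Part 1, generation 18).  Source analysed: Yilei Chen, "Quantum Algorithms for Lattice Problems",
IACR ePrint 2024/555, version of 2024-04-18 (WITHDRAWN by the author: "Step 9 of the algorithm contains a
bug, which I don't know how to fix").  Bib key `ChenQuantumLattice2024`.
REPRODUCTION / ANALYSIS OF A CLAIMED RESULT UNDER ADJUDICATION (withdrawn).
-/
import Literature.Computability.Cryptography.ChenQuantumLWEHonestStepNine
import Literature.Computability.Cryptography.ChenQuantumLWEStepEightFinal

/-!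
# Chen (2024), §3.5.9 in one theorem: the Step-9 verdict, and the verdict on the quantum subroutine

REPRODUCTION / ANALYSIS OF A CLAIMED RESULT UNDER ADJUDICATION (withdrawn).  HONEST FRAMING: this module
ASSEMBLES, by name, the kernel-checked verdict on Step 9 (§3.5.9, "Proof of Lemma 3.8", pp. 34–38) of
Chen's withdrawn quantum LWE algorithm from the modules `ChenQuantumLWEProductProofs` (eq. (40) is a product
state), `ChenQuantumLWEDisplayRefutation` (the withdrawn p. 37 display is false), `ChenQuantumLWELemma38` /
`ChenQuantumLWEBornRule` (Lemma 3.8's certainty claim for eq. (41) fails on every branch, `Pr ≤ 1/Q`),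
`ChenQuantumLWEEq41Exact` (`Pr[(41)] = Pr[p₁ ∣ u₁]/Q` for every coordinate-1 post-processing; `= 1/P`
unprocessed), `ChenQuantumLWEHonestStepNine` (the honest run: `u₁` surely a multiple of `p₁`, `Pr[(41)] = 1/Q`,
output uniform on `{p₁ ∣ u₁}`) and `ChenQuantumLWESecretIndependence` (the output law does not depend on the
instance), and joins it with the Step-8 verdict `Shape.step8_verdict_final` of `ChenQuantumLWEStepEightFinal`.
The value is a THEOREM about a WITHDRAWN algorithm (a precise negative result) — NOT progress on LWE, on any
lattice problem or on quantum advantage; it repairs nothing and breaks nothing.  Nothing here is new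
mathematics: the two new `ℝ`-valued abbreviations package the Born probabilities that the cited theorems
compute; no `Prop` is defined and no named fact is introduced.

* `Shape.exists_bezout_of_isUnit` — the standing hypothesis of the Step-9 probability theorems, a Bezout
  witness `w` for `b*[2..n+1] mod Q` (the residues generate `ℤ_Q`), holds as soon as one residue is a unit —
  Chen's `b*` of eq. (39) has `b*_η ≡ b₁ = −1 (mod p_η)` and `b*_η ≡ b_η = 2p₁p_η (mod p_η′)` (`η′ ≠ η`,
  eq. (12)), so every `b*_η`, `2 ≤ η ≤ κ`, is a unit modulo `Q = p₂⋯p_κ`.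
* `Shape.probEq41 K` = `Pr_K[eq. (41)]`, `Shape.probHeadDvd K` = `Pr_K[p₁ ∣ u₁]` — the Born probabilities of
  the final measurement of `QFT (processed K)`, `K` any kernel on coordinate 1 replacing (9.e)–(9.g).
* `Shape.step9_verdict` — (i) `|φ8.f⟩` (eq. (40)) is a product state across coordinate 1 ⊗ coordinates
  `2..n+1`; (ii) `¬ Step9Display` (the p. 37 display is not Lemma 2.17 applied to coordinate 1);
  (iii) `¬ Lemma38Certainty |φ8.f⟩` and `¬ Lemma38Certainty (processed K)` for every isometry `K` on
  coordinate 1; (iv) `Pr_K[(41)] = Pr_K[p₁ ∣ u₁]/Q` for every `K`, hence `≤ 1/Q` on every branch that occurs;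
  (v) `= 1/P` when (9.e)–(9.g) are skipped, `= 1/Q` when they are performed honestly, where moreover
  `Pr[p₁ ∣ u₁] = 1` and the output is uniform on `{u : p₁ ∣ u₁}`; (vi) instance independence of every
  outcome probability, every `K`.
* `Shape.quantum_subroutine_verdict` — `step8_verdict_final ∧ step9_verdict`: the nine-step subroutine's two
  load-bearing lemmas decided — Lemma 3.13 (Step 8) holds exactly as printed and certifies `v′₁ mod D²p₁`
  only (with the exact, alphabet-free measurement tolerance `1/(𝔭(Q)² + 1)`), Lemma 3.8's Step 9 fails —
  eq. (41) holds with probability exactly `1/Q` in the honest run (`1/P` if (9.e)–(9.g) are skipped,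
  `≤ 1/Q` whatever is done to coordinate 1), not with certainty.

Paper coordinate `1` = Lean index `0`; paper `u₁` = Lean `u 0`.  [cite: ChenQuantumLattice2024, §3.5.9
pp. 34–38 (eq. (39)–(40) p. 36, display and author's note p. 37, eq. (41) p. 38), Lemma 3.8 p. 21,
eq. (12) p. 17, Cond. C.3 p. 18, §3.5.8 pp. 32–34; NielsenChuang2010, §2.2.5 pp. 84–87 (Born rule)]
-/

open scoped BigOperators ComplexOrder MatrixOrder
open Finset

namespace Literature.Computability.Cryptography.Chen2024

namespace Shape

variable (S : Shape)

/-! ### The Bezout hypothesis on `b*[2..n+1] mod Q` -/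

/-- The standing hypothesis of the Step-9 probability theorems (`prob_eq41_eq`, `prob_eq41_le`, …) is a
Bezout witness `w` for `b*[2..n+1] mod Q`, `Σ_t w_t·b*_{t+1} ≡ 1 (mod Q)` (Lean indices `1..n`; the residues
generate `ℤ_Q`).  One coordinate that is a unit modulo `Q` gives one.  In Chen's setting (eq. (12):
`b = (−1, 2p₁p₂, …, 2p₁p_κ, …)`; eq. (39): the `p_η`-slot of `b*_η` is `b₁ = −1`, its other slots are those
of `b_η = 2p₁p_η`) every `b*_η` with `2 ≤ η ≤ κ` is such a unit modulo `Q = p₂⋯p_κ`.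
[cite: ChenQuantumLattice2024, eq. (12) p. 17, eq. (39) p. 36, Cond. C.3 p. 18] -/
theorem exists_bezout_of_isUnit (t : Fin S.n) (hu : IsUnit ((S.bstar (Fin.succ t) : ℤ) : ZMod S.Q)) :
    ∃ w : Fin S.n → ℤ, ((∑ t, w t * S.bstar (Fin.succ t) : ℤ) : ZMod S.Q) = 1 := by
  haveI : NeZero (S.Q : ℕ) := ⟨S.Q.ne_zero⟩
  obtain ⟨u, hu⟩ := hu
  refine ⟨fun s => if s = t then (((↑u⁻¹ : ZMod S.Q)).val : ℤ) else 0, ?_⟩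
  rw [Int.cast_sum, Finset.sum_eq_single t]
  · dsimp only
    rw [if_pos rfl, Int.cast_mul, Int.cast_natCast, ZMod.natCast_zmod_val, ← hu, Units.inv_mul]
  · intro s _ hs
    dsimp only
    rw [if_neg hs, zero_mul, Int.cast_zero]
  · intro ht
    exact absurd (Finset.mem_univ t) ht

/-! ### The two Born probabilities of the final measurement -/

/-- `Pr_K[eq. (41)]`: the Born probability that the outcome `u ∈ ℤ_N^{n+1}` of measuring
`QFT_{ℤ_N^{n+1}} (processed K)` satisfies eq. (41), `u₁ + ⟨b*[2..n+1], u[2..n+1]⟩ ≡ 0 (mod P)` — for the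
state `|φ8.f⟩` of eq. (40) post-processed on coordinate 1 by an arbitrary kernel `K` (Chen's (9.e)–(9.g):
`K = honestKernel`; skipping them: `K = 1`).  (Value `0/0 = 0` on a branch that does not occur.)
[cite: ChenQuantumLattice2024, eq. (41) p. 38; NielsenChuang2010, §2.2.5 p. 84] -/
noncomputable def probEq41 [DecidablePred S.eq41] (K : ZMod S.N → ZMod S.N → ℂ) : ℝ :=
  (∑ u ∈ univ.filter S.eq41, ‖qft (S.processed K) u‖ ^ 2) / ∑ u, ‖qft (S.processed K) u‖ ^ 2

/-- `Pr_K[p₁ ∣ u₁]`: the Born probability that coordinate 1 of the outcome is a multiple of `p₁`, same state.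
[cite: ChenQuantumLattice2024, §3.5.9 (9.h) p. 38; NielsenChuang2010, §2.2.5 p. 84] -/
noncomputable def probHeadDvd (K : ZMod S.N → ZMod S.N → ℂ) : ℝ :=
  (∑ u ∈ univ.filter (fun u : Fin (S.n + 1) → ZMod S.N => (S.p₁ : ℕ) ∣ (u 0).val),
      ‖qft (S.processed K) u‖ ^ 2) / ∑ u, ‖qft (S.processed K) u‖ ^ 2

/-- **`Pr_K[(41)] = Pr_K[p₁ ∣ u₁] / Q` for every kernel `K` on coordinate 1** (`Eq41Exact.prob_eq41_eq`).
[cite: ChenQuantumLattice2024, eq. (41) p. 38] -/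
theorem probEq41_eq (h : S.Admissible) [DecidablePred S.eq41]
    (w : Fin S.n → ℤ) (hw : ((∑ t, w t * S.bstar (Fin.succ t) : ℤ) : ZMod S.Q) = 1)
    (K : ZMod S.N → ZMod S.N → ℂ) : S.probEq41 K = S.probHeadDvd K / S.Q :=
  S.prob_eq41_eq h K w hw

/-- **`Pr_K[(41)] ≤ 1/Q` on every branch that occurs** (`BornRule.prob_eq41_le`); Lemma 3.8 claimed `1`.
[cite: ChenQuantumLattice2024, Lemma 3.8 p. 21, eq. (41) p. 38] -/
theorem probEq41_le (h : S.Admissible) [DecidablePred S.eq41]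
    (w : Fin S.n → ℤ) (hw : ((∑ t, w t * S.bstar (Fin.succ t) : ℤ) : ZMod S.Q) = 1)
    (K : ZMod S.N → ZMod S.N → ℂ) (hK : S.processed K ≠ 0) : S.probEq41 K ≤ 1 / S.Q :=
  S.prob_eq41_le h K w hw hK

/-- **Skipping (9.e)–(9.g)** (`K = 1`, the state `|φ8.f⟩` itself): `Pr[(41)] = 1/P`
(`Eq41Exact.prob_eq41_unprocessed`). [cite: ChenQuantumLattice2024, eq. (40) p. 36, eq. (41) p. 38] -/
theorem probEq41_id (h : S.Admissible) [DecidablePred S.eq41]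
    (w : Fin S.n → ℤ) (hw : ((∑ t, w t * S.bstar (Fin.succ t) : ℤ) : ZMod S.Q) = 1) :
    S.probEq41 (fun x y => if x = y then 1 else 0) = 1 / (S.P : ℕ) := by
  unfold probEq41
  rw [S.processed_one]
  exact S.prob_eq41_unprocessed h w hw

/-- **The honest run** (`K = honestKernel`: Lemma 2.17 on coordinate 1, division by `Q`, kickback by the
read-out `j`): `Pr[(41)] = 1/Q` (`HonestStepNine.prob_eq41_honest`).
[cite: ChenQuantumLattice2024, §3.5.9 (9.e)–(9.h) pp. 37–38] -/
theorem probEq41_honest (h : S.Admissible) [DecidablePred S.eq41]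
    (w : Fin S.n → ℤ) (hw : ((∑ t, w t * S.bstar (Fin.succ t) : ℤ) : ZMod S.Q) = 1) :
    S.probEq41 S.honestKernel = 1 / S.Q :=
  S.prob_eq41_honest h w hw

/-- In the honest run coordinate 1 of the outcome is surely a multiple of `p₁`
(`HonestStepNine.prob_head_dvd_honest`). [cite: ChenQuantumLattice2024, §3.5.9 (9.h) p. 38] -/
theorem probHeadDvd_honest (h : S.Admissible) : S.probHeadDvd S.honestKernel = 1 :=
  S.prob_head_dvd_honest h

/-! ### §3.5.9 in one theorem -/

/-- **Step 9 verdict (§3.5.9, "Proof of Lemma 3.8", pp. 34–38).**  For every admissible shape `S`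
(Chen's C.3, eq. (12), eq. (39)) with a Bezout witness for `b*[2..n+1] mod Q` (true for Chen's `b*`,
`exists_bezout_of_isUnit`):
1. STRUCTURE of eq. (40): `|φ8.f⟩` is a product state `|A⟩ ⊗ |B⟩` across coordinate 1 and coordinates
   `2..n+1` — coordinate 1 runs through `2D²p′·j mod D²p₁p′` (period `p₁` in `j`), the rest has period `p′`
   in `j`, `gcd(p₁, p′) = 1`; so no processing of coordinate 1 alone can correlate it with the rest;
2. THE WITHDRAWN DISPLAY (author's note p. 37: "Here is the bug: the amplitude of |φ8.f⟩ does not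
   satisfy M/2-periodicity … the expression of |φ8.g⟩ is wrong"): Lemma 2.17 applied to coordinate 1 of
   `|φ8.f⟩` is NOT the displayed `|φ8.g⟩`;
3. LEMMA 3.8's CERTAINTY CLAIM ("we always get u satisfying (41)"): false for `|φ8.f⟩` measured as is, and
   false after EVERY isometry `K` on coordinate 1 (every coherent replacement of (9.e)–(9.g));
4. THE EXACT LAW: for every kernel `K` on coordinate 1, `Pr_K[(41)] = Pr_K[p₁ ∣ u₁]/Q`; hence `≤ 1/Q` on
   every branch that occurs (`Q = p₂⋯p_κ ≥ 3`);
5. THE TWO RUNS OF INTEREST: skipping (9.e)–(9.g) gives `Pr[(41)] = 1/P`; performing them honestly gives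
   `Pr[p₁ ∣ u₁] = 1`, `Pr[(41)] = 1/Q`, and the outcome UNIFORM on `{u ∈ ℤ_N^{n+1} : p₁ ∣ u₁}`
   (`log₂ p₁` bits about coordinate 1, nothing else);
6. SECRET INDEPENDENCE: for every `K` and every outcome `u`, the outcome probability is the same for all
   admissible instances with the same public `(n, D, p₁, Q)` — the sample carries no information about
   the LWE secret (inside `b`, eq. (12)), `v′`, `b*`, `v*`.
[cite: ChenQuantumLattice2024, §3.5.9 pp. 34–38 (eq. (40) p. 36, p. 37 display and note, eq. (41) p. 38),
Lemma 3.8 p. 21, eq. (12) p. 17; NielsenChuang2010, §2.2.5 p. 84] -/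
theorem step9_verdict (h : S.Admissible) [DecidablePred S.eq41]
    (w : Fin S.n → ℤ) (hw : ((∑ t, w t * S.bstar (Fin.succ t) : ℤ) : ZMod S.Q) = 1) :
    IsProduct (splitFirst S.phi8f) ∧
    ¬ S.Step9Display ∧
    (¬ S.Lemma38Certainty S.phi8f ∧
      ∀ K : Matrix (ZMod S.N) (ZMod S.N) ℂ, star K * K = 1 → ¬ S.Lemma38Certainty (S.processed K)) ∧
    ((∀ K : ZMod S.N → ZMod S.N → ℂ, S.probEq41 K = S.probHeadDvd K / S.Q) ∧
      ∀ K : ZMod S.N → ZMod S.N → ℂ, S.processed K ≠ 0 → S.probEq41 K ≤ 1 / S.Q) ∧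
    (S.probEq41 (fun x y => if x = y then 1 else 0) = 1 / (S.P : ℕ) ∧
      S.probHeadDvd S.honestKernel = 1 ∧ S.probEq41 S.honestKernel = 1 / S.Q ∧
      ∀ (u₀ : ZMod S.N) (u' : Fin S.n → ZMod S.N),
        ‖qft (S.processed S.honestKernel) (Fin.cons u₀ u')‖ ^ 2
            / ∑ u, ‖qft (S.processed S.honestKernel) u‖ ^ 2
          = (if (S.p₁ : ℕ) ∣ u₀.val then ((S.p₁ : ℕ) : ℝ) else 0) / ((S.N : ℕ) : ℝ) ^ (S.n + 1)) ∧
    (∀ (b₂ v₂ c₂ w₂ : Fin (S.n + 1) → ℤ), (S.withVectors b₂ v₂ c₂ w₂).Admissible →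
      ∀ (K : ZMod S.N → ZMod S.N → ℂ) (u : Fin (S.n + 1) → ZMod S.N),
        ‖qft ((S.withVectors b₂ v₂ c₂ w₂).processed K) u‖ ^ 2
            / ∑ v : Fin (S.n + 1) → ZMod S.N, ‖qft ((S.withVectors b₂ v₂ c₂ w₂).processed K) v‖ ^ 2
          = ‖qft (S.processed K) u‖ ^ 2 / ∑ v, ‖qft (S.processed K) v‖ ^ 2) := by
  refine ⟨S.phi8f_isProduct h, S.not_step9Display h,
    ⟨S.not_lemma38Certainty_phi8f h w hw, fun K hK => S.not_lemma38Certainty_of_star_mul_self h K hK w hw⟩,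
    ⟨fun K => S.probEq41_eq h w hw K, fun K hK => S.probEq41_le h w hw K hK⟩,
    ⟨S.probEq41_id h w hw, S.probHeadDvd_honest h, S.probEq41_honest h w hw,
      fun u₀ u' => S.prob_outcome_honest h u₀ u'⟩,
    fun b₂ v₂ c₂ w₂ h₂ K u => S.prob_instance_indep h h₂ K u⟩

/-- **The quantum subroutine's two load-bearing lemmas, decided** (§3.5.8 + §3.5.9): Step 8 (Lemma 3.13)
holds exactly as printed — Claim 3.14, sure non-demolition read-out of `v′₁ mod D²p₁`, exact reversal — and
no approximately-non-demolition fifth operation can supply the Step-9 datum `v′₁ mod D²P` below the exact,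
alphabet-free tolerance `1/(𝔭(Q)² + 1)` (`step8_verdict_final`); Step 9 (Lemma 3.8) fails: the displayed
state is not produced, eq. (41) holds with probability `Pr[p₁ ∣ u₁]/Q ≤ 1/Q`, never with certainty, and
the output law is secret-independent (`step9_verdict`).  The author's withdrawal note locates the bug in
Step 9; these theorems say precisely what Step 9 delivers instead.
[cite: ChenQuantumLattice2024, §3.5.8 pp. 32–34, §3.5.9 pp. 34–38, update note p. 1 and notes pp. 32, 37] -/
theorem quantum_subroutine_verdict (h : S.Admissible) (U : Finset (Fin (S.n + 1)))
    [DecidablePred S.eq41] (w : Fin S.n → ℤ) (hw : ((∑ t, w t * S.bstar (Fin.succ t) : ℤ) : ZMod S.Q) = 1) :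
    (S.Claim314 S.phi7d
      ∧ ((∀ r, S.fifthOp r S.phi7d = if r = S.read8Value then S.phi7d else 0)
          ∧ S.step8Output = ((((S.D : ℕ) * S.read8Value.val : ℕ)) : ZMod ((S.D : ℕ) ^ 2 * S.p₁))
          ∧ ∃ c : ℂ, c ≠ 0 ∧ S.reverse8 (S.fifthOp S.read8Value S.phi7d) = c • S.phi7)
      ∧ ((S.inst S.b S.shiftV).Admissible ∧ (S.inst S.b S.shiftV).step8Output = S.step8Output
          ∧ (S.inst S.b S.shiftV).step9Needs ≠ S.step9Needs)
      ∧ ((∀ {κ : Type} [Fintype κ] [DecidableEq κ] (t₁ : Fin S.n), t₁.succ ∈ U →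
            ∀ (E : POVM (Fin (S.n + 1) → ZMod S.M) κ) {ε : ℝ},
              (∀ p ∈ (S.Q : ℕ).primeFactors, ε * ((p : ℝ) ^ 2 + 1) < 1) → S.AlmostSureOn ε U E →
                ∀ k k' : κ, E.AlmostCertain ε S.phi7d k →
                  E.AlmostCertain ε (S.inst S.b S.shiftV).phi7d k' → k = k')
          ∧ ∀ p ∈ (S.Q : ℕ).primeFactors, ∃ (E : POVM (Fin (S.n + 1) → ZMod S.M) (Fin 2)) (k k' : Fin 2),
              S.AlmostSureOn (1 / ((p : ℝ) ^ 2 + 1)) U E ∧ k ≠ k'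
              ∧ E.AlmostCertain (1 / ((p : ℝ) ^ 2 + 1)) S.phi7d k
              ∧ E.AlmostCertain (1 / ((p : ℝ) ^ 2 + 1)) (S.inst S.b S.shiftV).phi7d k')
      ∧ (∀ {κ : Type} [Fintype κ] [DecidableEq κ] (k₀ k₁ : κ), k₀ ≠ k₁ → ∀ t₁ : Fin S.n, t₁.succ ∈ U →
          ∀ ε : ℝ,
            (∀ E : POVM (Fin (S.n + 1) → ZMod S.M) κ, S.AlmostSureOn ε U E →
                ∀ k k' : κ, E.AlmostCertain ε S.phi7d k →
                  E.AlmostCertain ε (S.inst S.b S.shiftV).phi7d k' → k = k')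
              ↔ ∀ p ∈ (S.Q : ℕ).primeFactors, ε * ((p : ℝ) ^ 2 + 1) < 1))
    ∧ (IsProduct (splitFirst S.phi8f) ∧
      ¬ S.Step9Display ∧
      (¬ S.Lemma38Certainty S.phi8f ∧
        ∀ K : Matrix (ZMod S.N) (ZMod S.N) ℂ, star K * K = 1 → ¬ S.Lemma38Certainty (S.processed K)) ∧
      ((∀ K : ZMod S.N → ZMod S.N → ℂ, S.probEq41 K = S.probHeadDvd K / S.Q) ∧
        ∀ K : ZMod S.N → ZMod S.N → ℂ, S.processed K ≠ 0 → S.probEq41 K ≤ 1 / S.Q) ∧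
      (S.probEq41 (fun x y => if x = y then 1 else 0) = 1 / (S.P : ℕ) ∧
        S.probHeadDvd S.honestKernel = 1 ∧ S.probEq41 S.honestKernel = 1 / S.Q ∧
        ∀ (u₀ : ZMod S.N) (u' : Fin S.n → ZMod S.N),
          ‖qft (S.processed S.honestKernel) (Fin.cons u₀ u')‖ ^ 2
              / ∑ u, ‖qft (S.processed S.honestKernel) u‖ ^ 2
            = (if (S.p₁ : ℕ) ∣ u₀.val then ((S.p₁ : ℕ) : ℝ) else 0) / ((S.N : ℕ) : ℝ) ^ (S.n + 1)) ∧
      (∀ (b₂ v₂ c₂ w₂ : Fin (S.n + 1) → ℤ), (S.withVectors b₂ v₂ c₂ w₂).Admissible →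
        ∀ (K : ZMod S.N → ZMod S.N → ℂ) (u : Fin (S.n + 1) → ZMod S.N),
          ‖qft ((S.withVectors b₂ v₂ c₂ w₂).processed K) u‖ ^ 2
              / ∑ v : Fin (S.n + 1) → ZMod S.N, ‖qft ((S.withVectors b₂ v₂ c₂ w₂).processed K) v‖ ^ 2
            = ‖qft (S.processed K) u‖ ^ 2 / ∑ v, ‖qft (S.processed K) v‖ ^ 2)) :=
  ⟨S.step8_verdict_final h U, S.step9_verdict h w hw⟩

end Shape

end Literature.Computability.Cryptography.Chen2024
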